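import Summits.ValiantsHypothesis.ValiantsHypothesis.Theorems.SuccinctLiftCharTwoParity

/-!
# Line `char2`, stub T2 = `BoolBridgeF2` (stmt 26304) — PROOF, part 2: the parity gate per operand,
the induction over the gate list, and the theorem `boolBridgeF2_proof`.  Part 1 (atoms, the
invariant, operand lemmas) is `Theorems/SuccinctLiftCharTwoParity.lean`.
-/

namespace Summit.ValiantsHypothesis.ValiantsHypothesis.Theorems.SuccinctLiftCharTwo.T2
open Literature.Computability.AlgebraicComplexity
open Literature.Computability.AlgebraicComplexity.ArithCircuit (Operand gateValues gateWDepths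
  gateValues_append_singleton gateValues_length gateWDepths_append_singleton gateWDepths_length
  le_foldr_max_of_mem)
open Literature.Computability.QuantumComplexity.PelegShpilkaVolk (zmod2_cases)
open Literature.Computability.Complexity (ACRealOver accBasis acBasis GateFn acBasis_subset_accBasis
  acRealOver_input acRealOver_const acRealOver_gate acRealOver_forall acRealOver_forall_const)
open scoped Classical
noncomputable section
variable {σ : Type} {M : ℕ} (e : Fin M ≃ σ)
/-! ### One parity gate per operand -/

section Par
variable {e} {s : ℕ} {gs : List (ArithCircuit.Gate (ZMod 2) σ)}
/-- Helper `modGate_mem_accBasis` of the char-2 line (see the module docstring). -/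
theorem modGate_mem_accBasis (r : ℕ) : GateFn.modGate 2 r ∈ accBasis 2 := by
  unfold accBasis
  exact Set.mem_union_right _ (Set.mem_iUnion.2 ⟨r, Set.mem_singleton _⟩)

/-- Every atom is realized in depth `2·(its depth) + 1`. -/
theorem Inv.atomReal (hI : Inv e s gs) (u : Operand (ZMod 2) σ) {a : Atom σ}
    (ha : a ∈ atomsOp (atomsList gs) u) :
    ACRealOver (accBasis 2) (fun x : Fin M → Bool => decide (chi e (gateValues gs) x a = 1))
      (2 * atomDepth (gateWDepths pw gs) a + 1)
      ((2 * s + 3) ^ (2 * atomDepth (gateWDepths pw gs) a)) := by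
  cases a with
  | var i =>
    refine ((acRealOver_input (accBasis 2) (e.symm i)).mono (Nat.zero_le _) (Nat.zero_le _)).congr ?_
    intro x
    simp only [chi, pt]
    rcases Bool.eq_false_or_eq_true (x (e.symm i)) with h | h <;> simp [h]
  | one =>
    refine ((acRealOver_const (acBasis_subset_accBasis 2) true).mono (by simp [atomDepth]) ?_).congr ?_
    · exact Nat.one_le_pow _ _ (by omega)
    · intro x; simp [chi]
  | pg j =>
    obtain ⟨-, args, hargs⟩ := hI.pgOp u ha
    exact hI.real j args hargs

/-- **PAR.** The value of any operand is realized by ONE parity gate over its atoms: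
depth `2·depthIn + 2`, size `(2s+3)^(2·depthIn + 1)`. -/
theorem Inv.par (hI : Inv e s gs) (u : Operand (ZMod 2) σ) :
    ACRealOver (accBasis 2)
      (fun x : Fin M → Bool => decide (MvPolynomial.eval (pt e x) (u.eval (gateValues gs)) = 1))
      (2 * u.depthIn (gateWDepths pw gs) + 2)
      ((2 * s + 3) ^ (2 * u.depthIn (gateWDepths pw gs) + 1)) := by
  set A := atomsOp (atomsList gs) u with hA
  set d := u.depthIn (gateWDepths pw gs) with hd
  have hrs : A.card ≤ s + 2 := hI.card_atomsOp u
  set r := A.card with hr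
  let enum : Fin r ≃ A := A.equivFin.symm
  have hatom : ∀ i : Fin r, ACRealOver (accBasis 2)
      (fun x : Fin M → Bool => decide (chi e (gateValues gs) x (enum i).1 = 1))
      (2 * d + 1) ((2 * s + 3) ^ (2 * d)) := by
    intro i
    have hmem : (enum i).1 ∈ A := (enum i).2
    have hdep : atomDepth (gateWDepths pw gs) (enum i).1 ≤ d := hI.depOp u hmem
    exact (hI.atomReal u hmem).mono (by omega) (Nat.pow_le_pow_right (by omega) (by omega))
  have hg := acRealOver_gate (ι := Fin M) (GateFn.modGate 2 r) (modGate_mem_accBasis r)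
    (f := fun i x => decide (chi e (gateValues gs) x (enum i).1 = 1)) (s := fun _ => (2 * s + 3) ^ (2 * d))
    hatom
  refine (hg.mono le_rfl ?_).congr ?_
  · -- size: r·X + 1 ≤ (2s+3)·X
    simp only [Finset.sum_const, Finset.card_univ, Fintype.card_fin, smul_eq_mul]
    show r * (2 * s + 3) ^ (2 * d) + 1 ≤ (2 * s + 3) ^ (2 * d + 1)
    have hX : 1 ≤ (2 * s + 3) ^ (2 * d) := Nat.one_le_pow _ _ (by omega)
    rw [pow_succ]
    nlinarith [hX, hrs]
  · intro x
    -- the parity gate computes the parity of the atom values = the operand's value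
    have hcount : ((GateFn.numOnes fun i : Fin r => decide (chi e (gateValues gs) x (enum i).1 = 1) : ℕ) :
        ZMod 2) = MvPolynomial.eval (pt e x) (u.eval (gateValues gs)) := by
      rw [hI.semOp u x, GateFn.numOnes, Finset.natCast_card_filter]
      have h1 : ∀ i : Fin r, (if decide (chi e (gateValues gs) x (enum i).1 = 1) = true then (1 : ZMod 2)
          else 0) = chi e (gateValues gs) x (enum i).1 := by
        intro i
        rcases zmod2_cases (chi e (gateValues gs) x (enum i).1) with h | h <;> simp [h]
      rw [Finset.sum_congr rfl (fun i _ => h1 i)]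
      rw [← Finset.sum_coe_sort A]
      exact Fintype.sum_equiv enum _ _ (fun i => rfl)
    simp only [GateFn.modGate]
    rw [Bool.eq_iff_iff]
    simp only [decide_eq_true_eq]
    rw [← hcount, ZMod.natCast_eq_one_iff_odd, Nat.odd_iff]
    omega

end Par

/-! ### The invariant is preserved by appending a gate -/

section Snoc
variable {e} {s : ℕ} {gs : List (ArithCircuit.Gate (ZMod 2) σ)}
/-- Helper `chi_snoc` of the char-2 line (see the module docstring). -/
theorem chi_snoc (g : ArithCircuit.Gate (ZMod 2) σ) (x : Fin M → Bool) {a : Atom σ}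
    (ha : ∀ j', a = Atom.pg j' → j' < gs.length) :
    chi e (gateValues (gs ++ [g])) x a = chi e (gateValues gs) x a := by
  cases a with
  | var i => rfl
  | one => rfl
  | pg j' =>
    have hj := ha j' rfl
    simp only [chi, gateValues_append_singleton]
    rw [getD_append_left' _ _ _ (by rw [gateValues_length]; exact hj)]

/-- Helper `atomDepth_snoc` of the char-2 line (see the module docstring). -/
theorem atomDepth_snoc (g : ArithCircuit.Gate (ZMod 2) σ) {a : Atom σ}
    (ha : ∀ j', a = Atom.pg j' → j' < gs.length) :
    atomDepth (gateWDepths pw (gs ++ [g])) a = atomDepth (gateWDepths pw gs) a := by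
  cases a with
  | var i => rfl
  | one => rfl
  | pg j' =>
    have hj := ha j' rfl
    simp only [atomDepth, gateWDepths_append_singleton]
    rw [getD_append_left' _ _ _ (by rw [gateWDepths_length]; exact hj)]

/-- Semantics of a weighted sum = parity over `sumAtoms`. -/
theorem Inv.semSum (hI : Inv e s gs) (x : Fin M → Bool)
    (args : List (ZMod 2 × Operand (ZMod 2) σ)) :
    MvPolynomial.eval (pt e x) ((args.map fun a => a.1 • a.2.eval (gateValues gs)).sum) =
      ∑ a ∈ sumAtoms (atomsList gs) args, chi e (gateValues gs) x a := by
  induction args with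
  | nil => simp [sumAtoms]
  | cons ca rest ih =>
    rw [List.map_cons, List.sum_cons, map_add, MvPolynomial.smul_eval, ih, hI.semOp ca.2 x]
    simp only [sumAtoms]
    rcases zmod2_cases ca.1 with h | h
    · rw [if_neg (by rw [h]; decide), h, zero_mul, zero_add]
    · rw [if_pos h, h, one_mul, sum_symmDiff_zmod2]

/-- Helper `inv_snoc` of the char-2 line (see the module docstring). -/
theorem inv_snoc (hI : Inv e s gs) (g : ArithCircuit.Gate (ZMod 2) σ)
    (hs : ((gs ++ [g]).map ArithCircuit.Gate.fanIn).sum ≤ s) : Nonempty (Inv e s (gs ++ [g])) := by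
  have hL : (atomsList gs).length = gs.length := atomsList_length gs
  have hVL : (gateValues gs).length = gs.length := gateValues_length gs
  have hDL : (gateWDepths pw gs).length = gs.length := gateWDepths_length _ gs
  have hlen' : (gs ++ [g]).length = gs.length + 1 := by simp
  -- the new entries
  have hVnew : (gateValues (gs ++ [g])).getD gs.length 0 = g.eval (gateValues gs) := by
    have := getD_append_length' (gateValues gs) (g.eval (gateValues gs)) 0
    rw [hVL] at this
    rw [gateValues_append_singleton]; exact this
  have hAnew : (atomsList (gs ++ [g])).getD gs.length ∅ = gateAtoms (atomsList gs) gs.length g := by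
    have := getD_append_length' (atomsList gs) (gateAtoms (atomsList gs) gs.length g) ∅
    rw [hL] at this
    rw [atomsList_append_singleton, hL]; exact this
  have hDnew : (gateWDepths pw (gs ++ [g])).getD gs.length 0 =
      pw g + ((g.args.map (Operand.depthIn (gateWDepths pw gs))).foldr max 0) := by
    have := getD_append_length' (gateWDepths pw gs)
      (pw g + ((g.args.map (Operand.depthIn (gateWDepths pw gs))).foldr max 0)) 0
    rw [hDL] at this
    rw [gateWDepths_append_singleton]; exact this
  -- the old entries
  have hVold : ∀ j, j < gs.length → (gateValues (gs ++ [g])).getD j 0 = (gateValues gs).getD j 0 := by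
    intro j hj
    rw [gateValues_append_singleton, getD_append_left' _ _ _ (by rw [hVL]; exact hj)]
  have hAold : ∀ j, j < gs.length → (atomsList (gs ++ [g])).getD j ∅ = (atomsList gs).getD j ∅ := by
    intro j hj
    rw [atomsList_append_singleton, getD_append_left' _ _ _ (by rw [hL]; exact hj)]
  have hDold : ∀ j, j < gs.length →
      (gateWDepths pw (gs ++ [g])).getD j 0 = (gateWDepths pw gs).getD j 0 := by
    intro j hj
    rw [gateWDepths_append_singleton, getD_append_left' _ _ _ (by rw [hDL]; exact hj)]
  have hAbig : ∀ j, gs.length < j → (atomsList (gs ++ [g])).getD j ∅ = ∅ := by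
    intro j hj
    exact getD_of_length_le' _ _ (by rw [atomsList_length, hlen']; omega)
  -- atoms of old entries / of the new sum gate refer to earlier gates only
  have hpg_old : ∀ j, ∀ a ∈ (atomsList gs).getD j ∅, ∀ j', a = Atom.pg j' → j' < gs.length := by
    intro j a ha j' h; subst h; exact (hI.pgok j j' ha).1
  have hpg_sum : ∀ args, ∀ a ∈ sumAtoms (atomsList gs) args, ∀ j', a = Atom.pg j' → j' < gs.length := by
    intro args a ha j' h; subst h
    obtain ⟨ca, -, hca⟩ := mem_sumAtoms ha
    exact (hI.pgOp ca.2 hca).1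
  refine ⟨?_⟩
  constructor
  · exact hs
  · -- sem
    intro j hj x
    rw [hlen'] at hj
    rcases Nat.lt_succ_iff_lt_or_eq.1 hj with hj | rfl
    · rw [hVold j hj, hAold j hj,
        Finset.sum_congr rfl (fun a ha => chi_snoc g x (hpg_old j a ha))]
      exact hI.sem j hj x
    · rw [hVnew, hAnew]
      cases g with
      | prod args =>
        simp only [gateAtoms, Finset.sum_singleton, chi]
        rw [hVnew]
      | sum args =>
        simp only [gateAtoms]
        rw [Finset.sum_congr rfl (fun a ha => chi_snoc _ x (hpg_sum args a ha))]
        exact hI.semSum x args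
  · -- pgok
    intro j j' h
    rcases lt_trichotomy j gs.length with hj | rfl | hj
    · rw [hAold j hj] at h
      obtain ⟨hj', args, hargs⟩ := hI.pgok j j' h
      exact ⟨by rw [hlen']; omega, args, by rw [List.getElem?_append_left hj']; exact hargs⟩
    · rw [hAnew] at h
      cases g with
      | prod args =>
        simp only [gateAtoms, Finset.mem_singleton, Atom.pg.injEq] at h
        subst h
        exact ⟨by rw [hlen']; omega, args, by simp⟩
      | sum args =>
        simp only [gateAtoms] at h
        obtain ⟨ca, -, hca⟩ := mem_sumAtoms h
        obtain ⟨hj', args', h'⟩ := hI.pgOp ca.2 hca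
        exact ⟨by rw [hlen']; omega, args', by rw [List.getElem?_append_left hj']; exact h'⟩
    · rw [hAbig j hj] at h
      simp at h
  · -- dep
    intro j a ha
    rcases lt_trichotomy j gs.length with hj | rfl | hj
    · rw [hAold j hj] at ha
      rw [atomDepth_snoc g (hpg_old j a ha), hDold j hj]
      exact hI.dep j a ha
    · rw [hAnew] at ha
      cases g with
      | prod args =>
        simp only [gateAtoms, Finset.mem_singleton] at ha
        subst ha
        exact le_rfl
      | sum args =>
        simp only [gateAtoms] at ha
        obtain ⟨ca, hmem, hca⟩ := mem_sumAtoms ha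
        rw [atomDepth_snoc _ (hpg_sum args a ha), hDnew]
        calc atomDepth (gateWDepths pw gs) a
            ≤ ca.2.depthIn (gateWDepths pw gs) := hI.depOp ca.2 hca
          _ ≤ ((ArithCircuit.Gate.sum args).args.map (Operand.depthIn (gateWDepths pw gs))).foldr
                max 0 :=
              le_foldr_max_of_mem (List.mem_map.2 ⟨ca.2, List.mem_map.2 ⟨ca, hmem, rfl⟩, rfl⟩)
          _ ≤ _ := Nat.le_add_left _ _
    · rw [hAbig j hj] at ha
      simp at ha
  · -- sub
    intro j args' h
    rcases Summit.ValiantsHypothesis.ValiantsHypothesis.Theorems.rowScanGates_getElem?_append_singleton h with ⟨hj, h'⟩ | ⟨rfl, hg⟩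
    · rw [hAold j hj]
      exact (hI.sub j args' h').trans (base_mono gs g)
    · subst hg
      rw [hAnew]
      simp only [gateAtoms]
      intro a ha
      obtain ⟨ca, hmem, hca⟩ := mem_sumAtoms ha
      rcases Finset.mem_insert.1 (hI.subOp ca.2 hca) with hk | hb
      · rw [hk]
        exact keyOf_mem_base_snoc gs _ ca.2 (List.mem_map.2 ⟨ca, hmem, rfl⟩)
      · exact base_mono gs _ hb
  · -- shape
    intro j g' h
    rcases Summit.ValiantsHypothesis.ValiantsHypothesis.Theorems.rowScanGates_getElem?_append_singleton h with ⟨hj, h'⟩ | ⟨rfl, hg⟩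
    · rw [hAold j hj]
      exact hI.shape j g' h'
    · subst hg
      exact ⟨atomsList gs, hAnew⟩
  · -- real
    intro j args' h
    rcases Summit.ValiantsHypothesis.ValiantsHypothesis.Theorems.rowScanGates_getElem?_append_singleton h with ⟨hj, h'⟩ | ⟨rfl, hg⟩
    · rw [hDold j hj]
      refine (hI.real j args' h').congr ?_
      intro x
      rw [hVold j hj]
    · subst hg
      set F := ((ArithCircuit.Gate.prod args').args.map (Operand.depthIn (gateWDepths pw gs))).foldr
        max 0 with hF
      have hD : (gateWDepths pw (gs ++ [ArithCircuit.Gate.prod args'])).getD gs.length 0 = F + 1 := by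
        rw [hDnew, add_comm]; rfl
      rw [hD]
      have hlenargs : args'.length ≤ s := by
        have : (ArithCircuit.Gate.prod args').fanIn = args'.length := rfl
        simp [List.map_append, List.sum_append] at hs
        omega
      have hX : 1 ≤ (2 * s + 3) ^ (2 * F + 1) := Nat.one_le_pow _ _ (by omega)
      have hargs : ∀ i : Fin args'.length, ACRealOver (accBasis 2)
          (fun x : Fin M → Bool =>
            decide (MvPolynomial.eval (pt e x) ((args'[i.1]'i.2).eval (gateValues gs)) = 1))
          (2 * F + 2) ((2 * s + 3) ^ (2 * F + 1)) := by
        intro i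
        have hle : (args'[i.1]'i.2).depthIn (gateWDepths pw gs) ≤ F :=
          le_foldr_max_of_mem (List.mem_map.2 ⟨args'[i.1]'i.2, List.getElem_mem _, rfl⟩)
        exact (hI.par (args'[i.1]'i.2)).mono (by omega) (Nat.pow_le_pow_right (by omega) (by omega))
      have hall := acRealOver_forall_const (acBasis_subset_accBasis 2) hargs
      refine (hall.mono (by omega) ?_).congr ?_
      · have h2 : (2 * s + 3) ^ (2 * (F + 1)) = (2 * s + 3) ^ (2 * F + 1) * (2 * s + 3) := by ring
        rw [h2]; nlinarith [hX, hlenargs]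
      · intro x
        rw [Bool.eq_iff_iff]
        simp only [decide_eq_true_eq]
        rw [hVnew]
        simp only [ArithCircuit.Gate.eval]
        rw [map_list_prod, zmod2_list_prod_eq_one_iff]
        simp only [List.map_map, List.forall_mem_map, Function.comp]
        constructor
        · intro hall' a ha
          obtain ⟨i, hi, rfl⟩ := List.getElem_of_mem ha
          exact hall' ⟨i, hi⟩
        · intro hall' i
          exact hall' _ (List.getElem_mem _)

end Snoc

/-! ### The theorem -/

/-- Helper `inv_all` of the char-2 line (see the module docstring). -/
theorem inv_all (e : Fin M ≃ σ) (s : ℕ) :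
    ∀ gs : List (ArithCircuit.Gate (ZMod 2) σ), (gs.map ArithCircuit.Gate.fanIn).sum ≤ s →
      Nonempty (Inv e s gs) := by
  intro gs
  induction gs using List.reverseRecOn with
  | nil => exact fun _ => inv_nil e s
  | append_singleton gs g ih =>
    intro h
    have h' : (gs.map ArithCircuit.Gate.fanIn).sum ≤ s := by
      simp [List.map_append, List.sum_append] at h; omega
    obtain ⟨hI⟩ := ih h'
    exact inv_snoc hI g h

end

end Summit.ValiantsHypothesis.ValiantsHypothesis.Theorems.SuccinctLiftCharTwo.T2

open Summit.ValiantsHypothesis.ValiantsHypothesis.Theorems.SuccinctLiftCharTwo.T2 in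
/-- **T2 = stmt-ValiantsHypothesis-26304 (`BoolBridgeF2`), proved.** -/
theorem Summit.ValiantsHypothesis.ValiantsHypothesis.Theorems.SuccinctLiftCharTwo.boolBridgeF2_proof :
    Summit.ValiantsHypothesis.ValiantsHypothesis.Theses.SuccinctLift.BoolBridgeF2 := by
  intro M σ e C Δ s hΔ hs
  obtain ⟨hI⟩ := inv_all e s C.gates hs
  have hpar := hI.par C.output
  have hpd : C.output.depthIn (Literature.Computability.AlgebraicComplexity.ArithCircuit.gateWDepths pw C.gates)
      = C.productDepth := rfl
  rw [hpd] at hpar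
  refine (hpar.mono (by omega) (Nat.pow_le_pow_right (by omega) (by omega))).congr ?_
  intro x
  rfl
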